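import Summits.BirchSwinnertonDyer.Rank1Residual.O6.X3KatoMemberBound
import Literature.NumberTheory.EllipticCurves.ComplexMultiplication
import Literature.NumberTheory.EllipticCurves.ComplexMultiplicationBurungaleFlachProofs
import Literature.NumberTheory.EllipticCurves.IsogenyIdProofs
import HarnessLib

/-!
# The CM rows of crux M (`O6.KatoMemberShaBoundOfReducible`, item 19196) are KERNEL over the routes' own held CM
# input `bsdTriple_of_hasCM_of_L_one_ne_zero` (Burungale–Flach 2024) and modularity — `W' = W`, slack `2·ord_p #tors`

Seat `bsd-potss-rkm` g29 (prover, cell `bsd-potss`), item stmt-BirchSwinnertonDyer-19196 `ReducibleKatoMember` = crux M of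
K9 `KatoDescentPotSupersingular` (support) / K8-t′ `KatoDescentTamePotSupersingular` (auto-crux); `--supports … --as helper`;
route-free (imports no `Theses.*` file); closes nothing.  HONEST FRAMING: BSD is proved for no curve by this file; nothing is
booked; crux M stays cite-level on {modularity, HELD 27962 `Kato2004.exists_memberHullZetaCoreInputs`}.

## What and why

Crux M (`Summit.BirchSwinnertonDyer.Rank1Residual.O6.KatoMemberShaBoundOfReducible`) quantifies over EVERY globally
minimal `W/ℚ` with `p ≠ 2` additive potentially good, `W[p]` reducible, `L(W,1) ≠ 0`, `Ш(W)` finite — CM curves included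
(e.g. `49a1` at `p = 7`, `27a1` at `p = 3`: the ramified primes of the CM field carry a rational `p`-isogeny and additive,
potentially good reduction).  The rkm lineage's atom-level road to M (g15–g28: Kato Thm. 13.4 + Serre's open image + H2X +
FW + Lim) is a NON-CM road (Thm. 13.4's hypothesis (v) fails for CM `f`, Kato p. 226), so any re-key of M over atoms must
treat the CM rows separately (g28 memo §5 «CM rows of M are outside the 13.4 road»).  They are in fact trivial over an input
BOTH routes already hold for their rank-0 CM rows (`PublishedInputCMRankZeroBSD[L]` :=
`bsdTriple_of_hasCM_of_L_one_ne_zero`, Burungale–Flach 2024 Thm. 1.1 / Cor. 2: RANK ∧ SHAFIN ∧ LEAD for every CM `E/ℚ` with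
`L(E,1) ≠ 0`): with `r_an = 0` (modularity reads `L(W,1) ≠ 0` as `r_an = 0`), `Reg = 1` and
`L(W,1) = #Ш(W)·Ω(W)·Tam(W)/#W(ℚ)_tors²`, so `q := L(W,1)/Ω(W) = #Ш·Tam/#tors² ∈ ℚ` and
`ord_p #Ш(W)[p^∞] + ord_p Tam(W) = ord_p q + 2·ord_p #W(ℚ)_tors` — M's inequality at `W' = W` with slack `2` (M allows `3`),
at EVERY prime `p` and with none of M's reduction / reducibility hypotheses used.

* §1 `exists_ratio_eq_and_padicValNat_sha_add_tamagawa_eq_of_bsdTriple` — pure bookkeeping: `BSDTriple W` + `r_an(W) = 0` ⟹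
  `∃ q, L(W,1)/Ω(W) = q ∧ ord_p #Ш(W)[p^∞] + ord_p Tam(W) = ord_p q + 2·ord_p #W(ℚ)_tors` (every prime `p`).
* §2 `exists_member_sha_add_tamagawa_le_of_hasCM` — the conclusion of M (its `∃ W'` literal shape) for a CM curve with
  `L(W,1) ≠ 0`, from the two named facts; `katoMemberShaBoundOfReducible_cmRows` — the same under M's full binder list plus
  `W.HasCM` (the shape a planner's CM/non-CM re-glue of M consumes).

References: A. Burungale, M. Flach, Camb. J. Math. 12 (2024), Thm. 1.1 and Cor. 2 [BurungaleFlach2024]; K. Rubin, Invent.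
Math. 103 (1991), Thm. 11.1 [Rubin1991MainConj]; K. Kato, Astérisque 295 (2004), Thm. 13.4 and the CM remark after it
(p. 226), §15 [Kato2004Asterisque]; R. L. Miller, LMS J. Comput. Math. 14 (2011) §1, Def. 1.1 [Miller2011LMS].
-/

-- the summit and its single problem are both named `BirchSwinnertonDyer` (registry layout D-0017)
set_option linter.dupNamespace false
set_option autoImplicit false

noncomputable section

open scoped Classical

open WeierstrassCurve Literature.NumberTheory.EllipticCurves
  Literature.NumberTheory.EllipticCurves.Rank1Residual

namespace Summit.BirchSwinnertonDyer.BirchSwinnertonDyer.Theorems.ReducibleKatoMemberCMRows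

/-! ## §1 Bookkeeping: the BSD triple in rank `0` gives M's inequality with slack `2·ord_p #tors`, as an equality -/

/-- **RANK ∧ SHAFIN ∧ LEAD in analytic rank `0` ⟹ `L(W,1)/Ω(W) = q ∈ ℚ` and
`ord_p #Ш(W)[p^∞] + ord_p Tam(W) = ord_p q + 2·ord_p #W(ℚ)_tors`** (every prime `p`).  From `W.BSDTriple`: `rank W(ℚ) = r_an = 0`,
so `Reg(W) = 1` (`regulator_eq_one_of_rank_zero`), the leading coefficient is `L(W,1)` (`leadingLCoeff_eq_of_analyticRank_eq_zero`), and
LEAD reads `L(W,1) = #Ш·Ω·Tam/#tors²`; take `q = #Ш·Tam/#tors²`.  Pure bookkeeping (Miller's currency).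
[cite: Miller2011LMS, §1 and Def. 1.1 (arXiv:1010.2431 p. 3)] -/
theorem exists_ratio_eq_and_padicValNat_sha_add_tamagawa_eq_of_bsdTriple (W : WeierstrassCurve ℚ) [W.IsElliptic]
    (hT : W.BSDTriple) (hr : W.analyticRank = 0) (p : ℕ) [Fact p.Prime] :
    Finite W.sha ∧ ∃ q : ℚ, W.entireLFunction 1 / (W.realPeriodRat : ℂ) = (q : ℂ) ∧
      (padicValNat p (Nat.card (AddCommGroup.primaryComponent W.sha p)) : ℤ) + padicValNat p W.tamagawaProduct =
        padicValRat p q + 2 * (padicValNat p W.torsionOrder : ℤ) := by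
  obtain ⟨hrank, hsha, hlead⟩ := hT
  haveI : Finite W.sha := hsha
  have hmw0 : W.mordellWeilRank = 0 := by rw [← hrank, hr]
  have hΩ0 : W.realPeriodRat ≠ 0 := W.realPeriodRat_pos_holds.ne'
  have hΩ : (W.realPeriodRat : ℂ) ≠ 0 := by exact_mod_cast hΩ0
  have hc0 : W.tamagawaProduct ≠ 0 := W.tamagawaProduct_pos_holds.ne'
  have ht0 : W.torsionOrder ≠ 0 := W.torsionOrder_pos_holds.ne'
  have hs0 : W.shaOrder ≠ 0 := (W.shaOrder_pos hsha).ne'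
  -- LEAD in rank `0`: `L(W,1) = #Ш · 1 · Ω · Tam / #tors²`
  have hL : W.entireLFunction 1 =
      ((W.shaOrder : ℝ) * W.realPeriodRat * (W.tamagawaProduct : ℝ) / (W.torsionOrder : ℝ) ^ 2 : ℝ) := by
    rw [← leadingLCoeff_eq_of_analyticRank_eq_zero W hr, hlead, bsdRHS_def, W.regulator_eq_one_of_rank_zero hmw0, mul_one]
  refine ⟨hsha, (W.shaOrder : ℚ) * (W.tamagawaProduct : ℚ) / (W.torsionOrder : ℚ) ^ 2, ?_, ?_⟩
  · rw [hL]
    push_cast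
    field_simp
  · have hsha' : padicValNat p (Nat.card (AddCommGroup.primaryComponent W.sha p)) = padicValNat p W.shaOrder := by
      unfold WeierstrassCurve.shaOrder
      exact padicValNat_card_addPrimaryComponent p
    have hsq : (W.shaOrder : ℚ) ≠ 0 := by exact_mod_cast hs0
    have hcq : (W.tamagawaProduct : ℚ) ≠ 0 := by exact_mod_cast hc0
    have htq : (W.torsionOrder : ℚ) ≠ 0 := by exact_mod_cast ht0
    rw [hsha', padicValRat.div (mul_ne_zero hsq hcq) (pow_ne_zero 2 htq), padicValRat.mul hsq hcq, pow_two,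
      padicValRat.mul htq htq, padicValRat.of_nat, padicValRat.of_nat, padicValRat.of_nat]
    ring

/-! ## §2 The CM rows of crux M -/

/-- **The conclusion of crux M on a CM row, from Burungale–Flach + modularity, at `W' = W`.**  For a globally minimal CM curve
`W/ℚ` with `L(W,1) ≠ 0` and ANY prime `p`: `Ш(W)` is finite, `L(W,1)/Ω(W) = q ∈ ℚ` and
`ord_p #Ш(W)[p^∞] + ord_p Tam(W) ≤ ord_p q + 3·ord_p #W(ℚ)_tors` (indeed `= ord_p q + 2·ord_p #W(ℚ)_tors`), packaged in M's
literal `∃ W'` shape with `W' = W` (`IsIsogenous.refl_holds`).  Conditional on the two named facts `bsdTriple_of_hasCM_of_L_one_ne_zero`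
(RANK ∧ SHAFIN ∧ LEAD for CM curves of analytic rank `0`) and `hasEntireLFunction_rat` (to read `L(W,1) ≠ 0` as `r_an = 0`).
[cite: BurungaleFlach2024, Thm. 1.1 and Cor. 2] [cite: Miller2011LMS, §1 and Def. 1.1] -/
theorem exists_member_sha_add_tamagawa_le_of_hasCM (hBF : bsdTriple_of_hasCM_of_L_one_ne_zero)
    (hmod : hasEntireLFunction_rat) (W : WeierstrassCurve ℚ) [W.IsElliptic] [W.IsGloballyMinimal] (p : ℕ) [Fact p.Prime]
    (hcm : W.HasCM) (hL : W.entireLFunction 1 ≠ 0) :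
    ∃ (W' : WeierstrassCurve ℚ) (_ : W'.IsElliptic) (_ : W'.IsGloballyMinimal),
      IsIsogenous W W' ∧ Finite W'.sha ∧
      ∃ q : ℚ, W'.entireLFunction 1 / (W'.realPeriodRat : ℂ) = (q : ℂ) ∧
        (padicValNat p (Nat.card (AddCommGroup.primaryComponent W'.sha p)) : ℤ) +
            padicValNat p W'.tamagawaProduct ≤
          padicValRat p q + 3 * (padicValNat p W'.torsionOrder : ℤ) := by
  have hr : W.analyticRank = 0 := (W.analyticRank_eq_zero_iff_holds (hmod W)).mpr hL
  obtain ⟨hsha, q, hq, heq⟩ := exists_ratio_eq_and_padicValNat_sha_add_tamagawa_eq_of_bsdTriple W (hBF W hcm hL) hr p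
  exact ⟨W, inferInstance, inferInstance, IsIsogenous.refl_holds (W := W), hsha, q, hq, by omega⟩

/-- **The CM rows of crux M** — M's binder list verbatim (`p ≠ 2`, additive potentially good, `W[p]` reducible, `L(W,1) ≠ 0`,
`Ш(W)` finite; the reduction and reducibility hypotheses are not used) plus `W.HasCM`: M's conclusion, from Burungale–Flach +
modularity.  The shape a CM / non-CM re-glue of `ReducibleKatoMember` would consume on its CM half.
[cite: BurungaleFlach2024, Thm. 1.1 and Cor. 2] [cite: Kato2004Asterisque, Thm. 13.4 and the CM remark following it (p. 226)] -/
theorem katoMemberShaBoundOfReducible_cmRows (hBF : bsdTriple_of_hasCM_of_L_one_ne_zero)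
    (hmod : hasEntireLFunction_rat) :
    ∀ (W : WeierstrassCurve ℚ) [W.IsElliptic] [W.IsGloballyMinimal] (p : ℕ) [Fact p.Prime],
      p ≠ 2 →
      ¬ W.HasGoodReductionAtPrime p → ¬ W.HasMultiplicativeReductionAtPrime p →
      0 ≤ padicValRat p W.j →
      ¬ W.HasIrreducibleModPGaloisRep p →
      W.entireLFunction 1 ≠ 0 → Finite W.sha → W.HasCM →
      ∃ (W' : WeierstrassCurve ℚ) (_ : W'.IsElliptic) (_ : W'.IsGloballyMinimal),
        IsIsogenous W W' ∧ Finite W'.sha ∧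
        ∃ q : ℚ, W'.entireLFunction 1 / (W'.realPeriodRat : ℂ) = (q : ℂ) ∧
          (padicValNat p (Nat.card (AddCommGroup.primaryComponent W'.sha p)) : ℤ) +
              padicValNat p W'.tamagawaProduct ≤
            padicValRat p q + 3 * (padicValNat p W'.torsionOrder : ℤ) :=
  fun W _ _ p _ _ _ _ _ _ hL _ hcm ↦ exists_member_sha_add_tamagawa_le_of_hasCM hBF hmod W p hcm hL

end Summit.BirchSwinnertonDyer.BirchSwinnertonDyer.Theorems.ReducibleKatoMemberCMRows

end
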